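import Literature.AnabelianGeometry.EtaleTheta.ThetaCoversAutCu

/-!
# [EtTh] Remark 2.6.1: `Aut_K(Z) = N_{Π^tp_C}(Π^tp_Z)/Π^tp_Z` computed on the PROFINITE side —
# the density transfer `autK (tp H) ≅ N_{Π_C}(H)/H` for open `H ⊆ Π_C` (proof-only companion)

Mochizuki, *The Étale Theta Function …* [EtTh], Publ. RIMS 45 (2009), §2, Remark 2.6.1, PRIMS text
p.40 (printed p.266; locators = PDF pages; bib key `MochizukiEtTh2009`) [cite: MochizukiEtTh2009,
Rmk 2.6.1 p.40]; the tempered/profinite dictionary is [SemiAnbd] Prop 3.6 / [EtTh] Lem 2.17 (ii) p.58.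

Cell abc-iut, layer L2, discharge seat abc-iut-L2-d3 (node EtTh:Rmk2.6.1), companion of seat
abc-iut-L2-t2's `ThetaCoversTempered.lean` (`TemperedCoverData.autK`, `Rmk261`) and of abc-iut-L6-t23's
`ThetaCoversAutCu.lean` (whose `toHat_mem_normalizer_PiCu` is the `H = Π_{C̲}` case of the transfer
below). Results, for `T : TemperedCoverData l` and an OPEN subgroup `H ⊆ Π_C` (`Π^tp_C ↪ Π_C` dense,
`T.isProfiniteCompletion_toHat`; `tp H = H ∩ Π^tp_C`):

* `normalizer_tp_eq_of_isOpen` — `N_{Π^tp_C}(H ∩ Π^tp_C) = N_{Π_C}(H) ∩ Π^tp_C`;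
* `exists_toHat_mem_coset` — every coset of `H` meets `Π^tp_C`;
* `nonempty_autK_tp_mulEquiv` — **`autK (tp H) = N_{Π^tp_C}(tp H)/tp H ≅ N_{Π_C}(H)/H`**;
* `nonempty_quotient_subgroupOf_congr`, `nonempty_top_quotient_mulEquiv` — bookkeeping for
  `N(H)/H` when `N(H)` is known (`= ⊤`, `= Π_{C̲}`).

No new definition, no named fact; nothing here asserts that a `TemperedCoverData` exists; no side is
taken on any disputed claim.
-/

namespace Literature.AnabelianGeometry.EtaleTheta

namespace ThetaCovers

universe u

/-! ### Bookkeeping: quotients `A/K` along an equality `A = B` -/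

/-- Transport of `A/(K ∩ A)` along an equality of subgroups `A = B` (bookkeeping for
`Aut_K(Z) = N(Π_Z)/Π_Z` once `N(Π_Z)` is computed). [cite: MochizukiEtTh2009, Rmk 2.6.1 p.40] -/
theorem nonempty_quotient_subgroupOf_congr {G : Type*} [Group G] {K A B : Subgroup G} (h : A = B)
    [hA : (K.subgroupOf A).Normal] [hB : (K.subgroupOf B).Normal] :
    Nonempty (↥A ⧸ K.subgroupOf A ≃* ↥B ⧸ K.subgroupOf B) := by
  subst h
  exact ⟨MulEquiv.refl _⟩

/-- `⊤/(K ∩ ⊤) ≅ G/K` for a normal subgroup `K` (the case `N(Π_Z) = Π_C` of `Aut_K(Z) = N(Π_Z)/Π_Z`).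
[cite: MochizukiEtTh2009, Rmk 2.6.1 p.40] -/
theorem nonempty_top_quotient_mulEquiv {G : Type*} [Group G] (K : Subgroup G) [K.Normal]
    [hT : (K.subgroupOf (⊤ : Subgroup G)).Normal] :
    Nonempty (↥(⊤ : Subgroup G) ⧸ K.subgroupOf ⊤ ≃* G ⧸ K) := by
  refine ⟨QuotientGroup.congr (K.subgroupOf ⊤) K Subgroup.topEquiv ?_⟩
  ext x
  constructor
  · rintro ⟨y, hy, rfl⟩
    exact hy
  · intro hx
    exact ⟨⟨x, Subgroup.mem_top x⟩, hx, rfl⟩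

namespace TemperedCoverData

variable {l : ℕ} (T : TemperedCoverData.{u} l)

/-! ### The density transfer for normalisers of open subgroups -/

/-- For an OPEN subgroup `H ⊆ Π_C` and `m ∈ Π^tp_C` normalising `tp H = H ∩ Π^tp_C`, the image of `m`
in `Π_C` normalises `H` (conjugation is continuous, `H` is open and closed, `Π^tp_C` is dense) — the
argument of `toHat_mem_normalizer_PiCu` for a general open `H`. [cite: MochizukiEtTh2009, Lem 2.17 (ii) p.58] -/
theorem toHat_mem_normalizer_of_isOpen {H : Subgroup T.PiC} (hH : IsOpen (H : Set T.PiC)) {m : T.Gtp}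
    (hm : m ∈ Subgroup.normalizer ((T.tp H : Subgroup T.Gtp) : Set T.Gtp)) :
    T.toHat m ∈ Subgroup.normalizer (H : Set T.PiC) := by
  have key : ∀ {m : T.Gtp}, m ∈ Subgroup.normalizer ((T.tp H : Subgroup T.Gtp) : Set T.Gtp) →
      ∀ y ∈ H, T.toHat m * y * (T.toHat m)⁻¹ ∈ H := by
    intro m hm y hy
    set c := T.toHat m with hc
    have hclosed : IsClosed (H : Set T.PiC) := Subgroup.isClosed_of_isOpen _ hH
    have hcont : Continuous fun y : T.PiC => c * y * c⁻¹ :=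
      (continuous_const.mul continuous_id).mul continuous_const
    have hA : IsClosed {y : T.PiC | c * y * c⁻¹ ∈ H} := hclosed.preimage hcont
    have hsub : (H : Set T.PiC) ∩ Set.range T.toHat ⊆ {y : T.PiC | c * y * c⁻¹ ∈ H} := by
      rintro _ ⟨hy, x, rfl⟩
      have hx : x ∈ T.tp H := hy
      have := (Subgroup.mem_normalizer_iff.mp hm x).mp hx
      change T.toHat (m * x * m⁻¹) ∈ H at this
      simpa [hc, map_mul, map_inv] using this
    have hdr : DenseRange T.toHat := T.isProfiniteCompletion_toHat.denseRange
    have hdense : (H : Set T.PiC) ⊆ closure ((H : Set T.PiC) ∩ Set.range T.toHat) :=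
      hdr.open_subset_closure_inter hH
    exact hA.closure_subset_iff.mpr hsub (hdense hy)
  rw [Subgroup.mem_normalizer_iff]
  intro y
  constructor
  · exact key hm y
  · intro hy
    have hm' : m⁻¹ ∈ Subgroup.normalizer ((T.tp H : Subgroup T.Gtp) : Set T.Gtp) :=
      Subgroup.inv_mem _ hm
    have := key hm' _ hy
    simpa [map_inv, mul_assoc] using this

/-- **`N_{Π^tp_C}(H ∩ Π^tp_C) = N_{Π_C}(H) ∩ Π^tp_C`** for an open subgroup `H ⊆ Π_C`.
[cite: MochizukiEtTh2009, Rmk 2.6.1 p.40] -/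
theorem normalizer_tp_eq_of_isOpen {H : Subgroup T.PiC} (hH : IsOpen (H : Set T.PiC)) :
    Subgroup.normalizer ((T.tp H : Subgroup T.Gtp) : Set T.Gtp) =
      T.tp (Subgroup.normalizer (H : Set T.PiC)) := by
  refine le_antisymm (fun m hm => T.toHat_mem_normalizer_of_isOpen hH hm) ?_
  change (Subgroup.normalizer (H : Set T.PiC)).comap T.toHat ≤ _
  exact Subgroup.le_normalizer_comap T.toHat

/-- Every coset `n·H` of an OPEN subgroup `H ⊆ Π_C` meets the dense subgroup `Π^tp_C`.
[cite: MochizukiEtTh2009, Rmk 2.6.1 p.40] -/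
theorem exists_toHat_mem_coset {H : Subgroup T.PiC} (hH : IsOpen (H : Set T.PiC)) (n : T.PiC) :
    ∃ m : T.Gtp, n⁻¹ * T.toHat m ∈ H := by
  have hdr : DenseRange T.toHat := T.isProfiniteCompletion_toHat.denseRange
  have hopen : IsOpen ((fun y : T.PiC => n⁻¹ * y) ⁻¹' (H : Set T.PiC)) :=
    hH.preimage (continuous_const.mul continuous_id)
  have hne : ((fun y : T.PiC => n⁻¹ * y) ⁻¹' (H : Set T.PiC)).Nonempty :=
    ⟨n, by simp⟩
  obtain ⟨m, hm⟩ := hdr.exists_mem_open hopen hne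
  exact ⟨m, hm⟩

/-- **`Aut_K` on the profinite side**: for an open subgroup `H ⊆ Π_C`,
`autK (tp H) = N_{Π^tp_C}(tp H)/tp H ≅ N_{Π_C}(H)/H` (restriction of `Π^tp_C ↪ Π_C`; surjective because
every coset of the open `H` in `N(H)` meets the dense `Π^tp_C`, kernel `tp H`).
[cite: MochizukiEtTh2009, Rmk 2.6.1 p.40] -/
theorem nonempty_autK_tp_mulEquiv {H : Subgroup T.PiC} (hH : IsOpen (H : Set T.PiC)) :
    Nonempty (T.autK (T.tp H) ≃* ↥(Subgroup.normalizer (H : Set T.PiC)) ⧸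
      H.subgroupOf (Subgroup.normalizer (H : Set T.PiC))) := by
  set NH := Subgroup.normalizer (H : Set T.PiC) with hNH
  set Nt := Subgroup.normalizer ((T.tp H : Subgroup T.Gtp) : Set T.Gtp) with hNt
  -- `toHat` restricted to the normalisers
  have hmap : ∀ m : ↥Nt, T.toHat (m : T.Gtp) ∈ NH := fun m =>
    T.toHat_mem_normalizer_of_isOpen hH m.2
  let f : ↥Nt →* ↥NH :=
    { toFun := fun m => ⟨T.toHat m, hmap m⟩
      map_one' := by ext; simp
      map_mul' := fun a b => by ext; simp }
  let g : ↥Nt →* ↥NH ⧸ H.subgroupOf NH := (QuotientGroup.mk' (H.subgroupOf NH)).comp f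
  have hg : ∀ m : ↥Nt, g m = QuotientGroup.mk (f m) := fun m => rfl
  -- surjective: every coset of `H` in `N(H)` meets `Π^tp_C`
  have hsurj : Function.Surjective g := by
    intro q
    induction q using QuotientGroup.induction_on with
    | H n =>
      obtain ⟨m, hm⟩ := T.exists_toHat_mem_coset hH (n : T.PiC)
      have hmN : T.toHat m ∈ NH := by
        rw [← mul_inv_cancel_left (n : T.PiC) (T.toHat m)]
        exact Subgroup.mul_mem _ n.2 (Subgroup.le_normalizer hm)
      have hmNt : m ∈ Nt := by
        rw [hNt, T.normalizer_tp_eq_of_isOpen hH]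
        exact hmN
      refine ⟨⟨m, hmNt⟩, ?_⟩
      rw [hg, eq_comm, QuotientGroup.eq, Subgroup.mem_subgroupOf]
      exact hm
  -- kernel `= tp H`
  have hker : g.ker = (T.tp H).subgroupOf Nt := by
    ext m
    rw [MonoidHom.mem_ker, hg, QuotientGroup.eq_one_iff, Subgroup.mem_subgroupOf,
      Subgroup.mem_subgroupOf]
    rfl
  exact ⟨(QuotientGroup.quotientMulEquivOfEq hker.symm).trans
    (QuotientGroup.quotientKerEquivOfSurjective g hsurj)⟩

end TemperedCoverData

end ThetaCovers

end Literature.AnabelianGeometry.EtaleTheta
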